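import Summits.AtomisticToContinuum.FouriersLaw.Theses.VanishingNoiseTransfer
import Summits.AtomisticToContinuum.FouriersLaw.Theses.JunctionLocality
import Summits.AtomisticToContinuum.FouriersLaw.Theorems.BoundedResponseConverges.Negative.OscillationExcluded
import Summits.AtomisticToContinuum.FouriersLaw.Theorems.FourierGreenKuboFourierFiniteResponseOfUnique
import Summits.AtomisticToContinuum.FouriersLaw.Theorems.JunctionLocalitySuperadditiveResistanceStubLinearResponsePlain

/-!
# `VanishingNoiseBound` is implied by the cruxes of route `JunctionLocality` plus `NoiseLocality`

`--supports stmt-AtomisticToContinuum-11976` file (crux `VanishingNoiseBound`, route `VanishingNoiseTransfer`; line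
`fekete-usc-one-length`, continuation lead c2, r7). The DEPENDENCY EDGE that makes the census of the line's one remaining
stub S1 (`stub_noisyJunctionDefect`, the ε-uniform junction defect) kernel-precise:

  `JunctionLocality.SuperadditiveResistance` (stmt-11748) ∧ `JunctionLocality.NonBallistic` (stmt-9127)
    ∧ `VanishingNoiseTransfer.NoiseLocality` (stmt-11975)  ⟹  `VanishingNoiseTransfer.VanishingNoiseBound` (stmt-11976),

with the closed items stmt-0741 `NessUnique`, stmt-0717 `FiniteResponseOfUnique` and stmt-11750 `PositiveConductance`
discharged by their landed proofs. So the crux needs NO mathematics beyond items already filed: its open content is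
(stmt-11748 ∨ S1) ∧ stmt-9127, transported to positive noise by the sibling crux stmt-11975. Proof (real analysis only):
at `ε = 0`, `PositiveConductance` makes `R_N(0) := (N−1)/D_N(0)` a resistance, `SuperadditiveResistance` gives the
junction constant `C`, `NonBallistic` gives ONE length `n ≥ 2` with `R_n(0) ≥ 2|C| + 2`, and Fekete at one length
(in-proof; the same real-variable core as the line's `flip_eventually_le_of_superadditive_oneLength`)
bounds `D_N(0) ≤ 2n` for `N ≥ 2n + 1`; the `N`-uniform modulus `w` of
`NoiseLocality` with `|w ε| ≤ 1/(4n)` for `ε ∈ (0, ε₁]` then transfers this to every small positive rate in division-free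
form: `D_N(ε) − D_N(0) ≤ w(ε) D_N(0) D_N(ε) ≤ D_N(ε)/2`, i.e. `D_N(ε) ≤ 2 D_N(0) ≤ 4n` eventually in `N`, hence every limit
`k = lim_N D_N(ε)` satisfies `k ≤ K := 4n`, uniformly in `ε ∈ (0, ε₁]`. (Compare the standing disprover's necessity lemma
`Cruxes/VanishingNoiseBound/Disproof.lean §1b crux_of_fouriersLaw_of_noiseLocality`, which goes through `FouriersLaw`;
here the Statement decl is never assumed.)

* `vanishingNoiseBound_of_junctionLocality` — the edge, with all closed items discharged;
* `helper_vanishingNoiseBoundOfJunctionLocality` — the registered helper sub-goal (same statement).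

No `sorry`, no definitions, no named facts.
-/

noncomputable section

open MeasureTheory Filter Topology
open Literature.MathematicalPhysics.KineticTheory.HeatConduction

namespace Summit.AtomisticToContinuum.FouriersLaw.Theorems.VanishingNoiseBound

/-- **`VanishingNoiseBound` from the `JunctionLocality` cruxes and `NoiseLocality`.** For `pinnedChain ω₂ lam β γ`
(all `> 0`) and `T > 0`: `SuperadditiveResistance` (stmt-11748) + `NonBallistic` (stmt-9127) bound the deterministic
responses, `D_N(0) ≤ 2n` for `N ≥ 2n+1` (`n` the one non-ballistic length; Fekete at one length, with the closed
items `NessUnique`, `FiniteResponseOfUnique`, `PositiveConductance` supplying the unique deterministic family, its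
responses and their positivity), and the `N`-uniform modulus of `NoiseLocality` (stmt-11975) transfers the bound to
every flip rate `ε ∈ (0, ε₁]`, `ε₁ ≤ 1` chosen with `|w ε| ≤ 1/(4n)`: `K = 4n`. [cite: BonettoLebowitzReyBellet2000, §6.3] -/
theorem vanishingNoiseBound_of_junctionLocality
    (hSR : Theses.JunctionLocality.SuperadditiveResistance)
    (hNB : Theses.JunctionLocality.NonBallistic)
    (hNL : Theses.VanishingNoiseTransfer.NoiseLocality) :
    Theses.VanishingNoiseTransfer.VanishingNoiseBound := by
  intro ω₂ lam β γ hω hl hβ hγ S hS T hT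
  have huniq := Theses.VanishingNoiseTransfer.NessUnique_holds ω₂ lam β γ hω hl hβ hγ
  -- (0) the unique deterministic steady family (landed existence theorem + NessUnique), by choice
  have hex : ∀ (N : ℕ) (T_L T_R : ℝ), 0 < T_L → 0 < T_R →
      ∃ μ : Measure (PhaseSpace N), (pinnedChain ω₂ lam β γ).IsSteadyState N T_L T_R μ :=
    fun N T_L T_R hL hR' => pinnedChain_exists_isSteadyState hω hl hβ hγ N hL hR'
  classical
  let μ0 : (N : ℕ) → ℝ → ℝ → Measure (PhaseSpace N) := fun N T_L T_R =>
    if h : 0 < T_L ∧ 0 < T_R then Classical.choose (hex N T_L T_R h.1 h.2) else 0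
  have hμ0 : ∀ (N : ℕ) (T_L T_R : ℝ), 0 < T_L → 0 < T_R →
      (pinnedChain ω₂ lam β γ).IsSteadyState N T_L T_R (μ0 N T_L T_R) := by
    intro N T_L T_R hL hR'
    simp only [μ0, dif_pos (And.intro hL hR')]
    exact Classical.choose_spec (hex N T_L T_R hL hR')
  -- its finite-`N` responses at `T` (FiniteResponseOfUnique, closed item stmt-0717)
  have hD0ex := Theorems.FourierGreenKubo.finiteResponse_of_unique ω₂ lam β γ hω hl hβ hγ huniq μ0 hμ0 T hT
  choose D0 hD0 using hD0ex
  -- positivity of the deterministic responses (PositiveConductance, closed item stmt-11750)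
  have hpos0 : ∀ N : ℕ, 2 ≤ N → 0 < D0 N :=
    Cruxes.SuperadditiveResistance.ThermaliseThenCutProbeInsertion.positiveConductance_proof
      ω₂ lam β γ hω hl hβ hγ huniq μ0 hμ0 T hT D0 hD0
  -- (1) the deterministic junction constant (SuperadditiveResistance, stmt-11748)
  obtain ⟨C, hC⟩ := hSR ω₂ lam β γ hω hl hβ hγ huniq μ0 hμ0 T hT D0 hD0 hpos0
  have hA : (0 : ℝ) < 2 * |C| + 2 := by positivity
  -- (2) NonBallistic (stmt-9127): ONE length `n ≥ 2` with `D_n(0) ≤ (n-1)/(2A)`, i.e. `R_n(0) ≥ 2|C| + 2`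
  obtain ⟨n, hn2, hn⟩ := hNB ω₂ lam β γ hω hl hβ hγ huniq μ0 hμ0 T hT D0 hD0
    (1 / (2 * |C| + 2)) (by positivity) 2
  have hn1 : (0 : ℝ) < (n : ℝ) - 1 := by
    have : (2 : ℝ) ≤ n := by exact_mod_cast hn2
    linarith
  have hn0 : (0 : ℝ) < n := by linarith
  have hbig : 2 * |C| + 2 ≤ ((n : ℝ) - 1) / D0 n := by
    rw [le_div_iff₀ (hpos0 n hn2)]
    have h1 : (2 * |C| + 2) * D0 n ≤ (2 * |C| + 2) * (1 / (2 * |C| + 2) * ((n : ℝ) - 1)) :=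
      mul_le_mul_of_nonneg_left hn hA.le
    have e : (2 * |C| + 2) * (1 / (2 * |C| + 2) * ((n : ℝ) - 1)) = (n : ℝ) - 1 := by
      field_simp
    linarith
  -- (3) Fekete at one length, at `ε = 0`: `D_N(0) ≤ 2n` eventually
  have hev0 : ∀ᶠ N in atTop, D0 N ≤ 2 * (n : ℝ) := by
    -- the superadditive sequence `a N = R_N(0) - C`, with `a n ≥ 1`
    set a : ℕ → ℝ := fun N => ((N : ℝ) - 1) / D0 N - C with ha
    have hsa : ∀ p m : ℕ, 2 ≤ p → 2 ≤ m → a p + a m ≤ a (p + m) := by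
      intro p m hp hm
      have h := hC p m hp hm
      simp only [ha]
      push_cast
      linarith
    have han : 1 ≤ a n := by
      have hC' : C ≤ |C| := le_abs_self C
      have e : a n = ((n : ℝ) - 1) / D0 n - C := rfl
      linarith
    refine eventually_atTop.2 ⟨2 * n + 1, fun N hN => ?_⟩
    have hN2 : 2 ≤ N := by omega
    -- `N = q n + r`, `2 ≤ r ≤ n + 1`; Fekete iteration `q · a n + a r ≤ a N`
    obtain ⟨q, r, hNqr, hr2, hrn⟩ := boundedResponseConverges_fekete_decomp hN2 hn2
    have hiter := conductanceLowerBound_iter_superadditive hsa hn2 hr2 q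
    rw [← hNqr] at hiter
    have hRr : 0 < ((r : ℝ) - 1) / D0 r := by
      have hr1 : (0 : ℝ) < (r : ℝ) - 1 := by
        have : (2 : ℝ) ≤ r := by exact_mod_cast hr2
        linarith
      exact div_pos hr1 (hpos0 r hr2)
    have har : -C ≤ a r := by
      have e : a r = ((r : ℝ) - 1) / D0 r - C := rfl
      linarith
    have hRN : (q : ℝ) ≤ ((N : ℝ) - 1) / D0 N := by
      have e : a N = ((N : ℝ) - 1) / D0 N - C := rfl
      have hq0 : (0 : ℝ) ≤ q := Nat.cast_nonneg q
      have hmul : (q : ℝ) * 1 ≤ (q : ℝ) * a n := mul_le_mul_of_nonneg_left han hq0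
      linarith
    have hq : ((N : ℝ) - 1) / (2 * n) ≤ q := by
      rw [div_le_iff₀ (by positivity)]
      have h1 : (N : ℝ) = q * n + r := by exact_mod_cast hNqr
      have h2 : (r : ℝ) ≤ n + 1 := by exact_mod_cast hrn
      have h3 : (2 * n + 1 : ℝ) ≤ N := by exact_mod_cast hN
      nlinarith
    have hN1 : (0 : ℝ) < (N : ℝ) - 1 := by
      have : (2 : ℝ) ≤ N := by exact_mod_cast hN2
      linarith
    have h : ((N : ℝ) - 1) / (2 * n) ≤ ((N : ℝ) - 1) / D0 N := hq.trans hRN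
    exact (div_le_div_iff_of_pos_left hN1 (by positivity) (hpos0 N hN2)).mp h
  -- (4) NoiseLocality (stmt-11975): the `N`-uniform modulus, small on `(0, ε₁]`
  obtain ⟨w, hw, hloc⟩ := hNL ω₂ lam β γ hω hl hβ hγ S hS T hT
  have h4n : (0 : ℝ) < 1 / (4 * n) := by positivity
  have hsmall : ∀ᶠ ε in 𝓝[Set.Ioi (0 : ℝ)] 0, |w ε| < 1 / (4 * n) := by
    have h := Metric.tendsto_nhds.1 hw (1 / (4 * n)) h4n
    refine h.mono fun ε hε' => ?_
    simpa [Real.dist_eq] using hε'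
  rw [eventually_nhdsWithin_iff, Metric.eventually_nhds_iff] at hsmall
  obtain ⟨r, hr, hrw⟩ := hsmall
  subst hS
  refine ⟨4 * (n : ℝ), min (r / 2) 1, lt_min (by linarith) one_pos, ?_⟩
  intro ε hε hεle μ hμ D k hD hk
  have hεr : ε ≤ r / 2 := hεle.trans (min_le_left _ _)
  have hε1 : ε ≤ 1 := hεle.trans (min_le_right _ _)
  have hwε : |w ε| < 1 / (4 * n) := by
    refine hrw ?_ (Set.mem_Ioi.2 hε)
    rw [Real.dist_eq, sub_zero, abs_of_pos hε]
    linarith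
  -- transfer at each length `N`: `|D_N(0) − D_N(ε)| ≤ w ε |D_N(0)| |D_N(ε)|`
  have hN : ∀ N : ℕ, |D0 N - D N| ≤ w ε * |D0 N| * |D N| := fun N =>
    hloc N ε hε hε1 (μ0 N) (μ N)
      (fun T_L T_R hL hR' => ⟨hμ0 N T_L T_R hL hR',
        fun ν hν => huniq N T_L T_R hL hR' ν _ hν (hμ0 N T_L T_R hL hR')⟩)
      (fun T_L T_R hL hR' => hμ N T_L T_R hL hR') (D0 N) (D N) (hD0 N) (hD N)
  -- hence `D_N(ε) ≤ 4n` eventually: division-free, `D − D0 ≤ w D0 D ≤ D/2` when `D0 ≤ 2n`, `|w| ≤ 1/(4n)`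
  have hev : ∀ᶠ N in atTop, D N ≤ 4 * (n : ℝ) := by
    filter_upwards [hev0, eventually_ge_atTop 2] with N hD0N hN2
    by_cases hDN : D N ≤ 0
    · linarith
    · have hDN : 0 < D N := not_le.mp hDN
      have h0 := hpos0 N hN2
      have h1 := hN N
      rw [abs_of_pos h0, abs_of_pos hDN] at h1
      have h2 : D N - D0 N ≤ w ε * D0 N * D N := by
        have := (abs_le.mp h1).1
        linarith
      have h3 : w ε * D0 N * D N ≤ 1 / (4 * n) * (2 * n) * D N := by
        have hw1 : w ε ≤ 1 / (4 * n) := (le_abs_self _).trans hwε.le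
        have : w ε * D0 N ≤ 1 / (4 * n) * (2 * n) := by
          calc w ε * D0 N ≤ |w ε| * D0 N := by gcongr; exact le_abs_self _
            _ ≤ 1 / (4 * n) * (2 * n) := by
              gcongr
        exact mul_le_mul_of_nonneg_right this hDN.le
      have e : 1 / (4 * (n : ℝ)) * (2 * n) = 1 / 2 := by
        field_simp
        ring
      rw [e] at h3
      linarith
  exact le_of_tendsto hk hev

/-- Registered helper sub-goal `helper_vanishingNoiseBoundOfJunctionLocality` of crux stmt-AtomisticToContinuum-11976 (line
`fekete-usc-one-length`, r7): the dependency edge `SuperadditiveResistance → NonBallistic → NoiseLocality → VanishingNoiseBound`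
(`vanishingNoiseBound_of_junctionLocality`). -/
theorem helper_vanishingNoiseBoundOfJunctionLocality : Theses.JunctionLocality.SuperadditiveResistance → Theses.JunctionLocality.NonBallistic → Theses.VanishingNoiseTransfer.NoiseLocality → Theses.VanishingNoiseTransfer.VanishingNoiseBound :=
  vanishingNoiseBound_of_junctionLocality

end Summit.AtomisticToContinuum.FouriersLaw.Theorems.VanishingNoiseBound

end
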